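import Literature.MathematicalPhysics.QuantumFieldTheory.Balaban1983to89.Beta.DriftRemainder
import Literature.MathematicalPhysics.QuantumFieldTheory.Balaban1983to89.TreeLengthTorusGeometry

/-!
# `Balaban1983to89.Beta.RemainderChainKP` — the remainder chain's FIRST LINK one display upstream: from LEMMA 3's
bound (2.38) on the activities H(Z) (the printed small-field estimate of [II] §2), the polymer geometry of 𝐃_{k+1}
CONSTRUCTED in the tree and the representation (2.13), to the (I.1.18)-shape bound on the (2.13)-terms with activity
`A_rem = O(1)·C₃·ε₁` — with the printed «O(1)» of (2.41) EXPLICIT, `O(1) = e·ν·c₁·K₀²`, k-free, volume-free,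
history-free (β sub-cell row BETA-an4 = the k-uniform remainder, unit `b2b-balaban-beta-an4` gen 6; bookkeeping BY NAME
over `Beta.RemainderChain`, `B13Resummation`, `TreeLengthTorusGeometry`, `Beta.DriftRemainder`)

HONEST FRAMING (cell `pub-balaban`, BETA-SPEC, verbatim): discharging `BetaPertH` makes Bałaban's UV stability
UNCONDITIONAL — a real constructive-QFT result; it is NOT the continuum limit and NOT the Clay problem.  (Gloss 1,
BETA-SPEC v1.8d/v1.9b l. 17–18, GAPS G-ref2-14 (a) / G-ref2-20 (a), verbatim: «UNCONDITIONAL» in [Balaban1989LargeFieldII]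
(B16) p. 355's interval-hypothesis sense ONLY (`FlowStepRuns.p355Unconditional_of_partialSums` keeps `hnodes`); the located
leaves G-adv3-2 (left inequality of (0.1)/(2.50), d = 4), G-adv3-1 (U2 transfer of B14 Cor. 3's lower bound) and
`SecondExpLeaf` REMAIN.  Gloss 2, BETA-SPEC v1.9e, beta-ref C-beta-78, BINDING: «unconditional» =
`Beta.Assembly.EventualForm`-unconditional END statement, NOT «Theorem 2 as printed».  Gloss 3 is PROPOSED ONLY
(BETA-SPEC v1.9n §7.17 (R10-3), NOT blessed by beta-ref, NOT binding): on the primary (composed) road of RULING (R10)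
«unconditional» = `FlowStepRuns.BetaPartialSumsLowerH`-unconditional END statement; never «Theorem 2 as printed», never
continuum / mass gap / Clay.)  THIS MODULE DISCHARGES NOTHING of Lemma 3, of the representation (2.13), of the
restriction property of the spaces, or of the [I] §§4–5 leaves: every theorem is a composition BY NAME of landed,
imported-untouched modules or `[folklore]` real arithmetic; nothing about Bałaban's β-functions (1.22) is asserted.
Value = the chain's (I1) link kernel-complete from the printed small-field bound with an explicit k-uniform constant
(audit cell `pub-balaban`, β sub-cell), NOT summit progress.

ABSOLUTE RULE (cell, verbatim): no internally-minted statement may enter as a cited fact; every hypothesis is either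
kernel-proved in this package or a verbatim quotation of a PUBLISHED theorem with page reference; the manuscripts under
audit are NOT citable for their own disputed steps.  Nothing below is cited as a fact; the `[cite: …]` tags on theorems
point at the printed display a theorem's conclusion has the SHAPE of, or at the printed CONTEXT of a hypothesis binder,
exactly as in `Beta.RemainderChain` / `Beta.DriftRemainder` / `B13Resummation`.

CITATION HEADER (lean-in-tree rule).  [II] = T. Bałaban, *Renormalization group approach to lattice gauge field
theories. II. Cluster expansions*, Commun. Math. Phys. **116** (1988) 1–22 [Balaban1988RG2Cluster] (cell paper B13;
journal page = PDF page; the quotations below are those already carried by the tree modules `…B13` and `…B13Resummation`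
and cross-read there (cell GAPS C-pv11-8, C-pv15-1, C-pv15-21, C-pv18-3) — nothing is newly quoted here).  Lemma 3, p. 20 [20],
verbatim: *"Under all the above restrictions on the constants M, κ, κ₁, α₀, α₁, α₄, α₆, γ₂, γ, ε₁, the activity H(Z) for
a localization domain Z ∈ 𝐃_{k+1} satisfies the inequality (2.38) |H(Z)| ≤ C₃ε₁ exp(−(1 − 8δ)½Lκd_{k+1}(Z))."*
(tree: `B13.Bound238`, general transfer factor `B13.Bound238With S c ℓ`; `C₃ = 2(L+2)⁴O(1)2E₀C₁α₄⁻¹α₆⁻¹M^q exp C₂κ₁`,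
p. 20, `B13.Consts.C3act` — ε₁-FREE).  p. 21 [21], verbatim: *"To the above sum we can repeat all the considerations
and bounds of the paper [26], for κ sufficiently large, and ε₁ sufficiently small. We obtain (2.40) … This yields
|E^{(k+1)}(X)| ≤ O(1)C₃ε₁ exp(−(1 − 10δ)½Lκd_{k+1}(X)). (2.41)"* and *"At first we assume that (1 − 10δ)½L = 1"*
(`B13.Consts.R22gen`).  The step (2.38) ⇒ (2.41) is a THEOREM in the tree from the Kotecký–Preiss theorem
(R. Kotecký, D. Preiss, Commun. Math. Phys. **103** (1986) 491–498, Theorem p. 492, PROVED in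
`Literature.Probability.LatticeModels.ClusterExpansionKPBound`): `B13Resummation.cammarotaStepWith_of_KP_R22gen` (unit
pv18), modulo the polymer geometry of 𝐃_{k+1} (`B13Resummation.Geometry` — CONSTRUCTED for the periodic carrier of the
papers in `TreeLengthTorusGeometry.tgeometry`, all inequality fields proved), the restriction property of the spaces
(p. 15, `SpRestr`) and the representation (2.13) (`Repr213`), with *"κ sufficiently large, and ε₁ sufficiently small"*
as two explicit inequalities and the printed O(1) `≥ e·ν·c₁·K₀²`.  [I] = T. Bałaban, CMP **109** (1987) 249–301
[Balaban1987RG1]: (4.4) p. 281 (the external-field polydisc, seam `RemainderChain.h118_of_bound118`), (4.37) p. 291,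
(5.10) p. 293, (1.20)–(1.22) p. 264 — CONTEXT of the leaves of `RemainderChain.PolLeaves`, unchanged here.

WHAT THE TREE HAD.  Row an4's chain `RemainderChain.Chain` starts at (2.41): its first link (L1) is
`bound118_linear_of_bound241With : Bound241With S c ℓ → R22gen ℓ → Bound118 … (remActivity c) c.κ` (activity
`A_rem = A₂·C₃·ε₁` LINEAR in ε₁, the second "last assumption" R23 NOT used), and the constant table of the cell record
`BETA/REMAINDER-BETA.md` §2 lists `A₂` = «the printed O(1) of (2.41), by reference to [26]» — LOCATED (GAPS G-B13-11),
not valued.  Meanwhile the tree acquired the Kotecký–Preiss discharge of (2.38) ⇒ (2.41) (`B13Resummation`, pv18) and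
the constructed polymer geometry on the torus with its constants ν = 2d + 1, κ₀ = κ₀(4·2^d, 2d), K₀ = K₀(4·2^d, 2d),
c₁ = 4·2^d (`TreeLengthTorusGeometry.tgeometry_consts`; d = 4: ν = 9, κ₀ = 64 log 162, c₁ = 64, `tgeometry_consts_four`).

WHAT THIS MODULE PROVES (compositions by name + [folklore] arithmetic).
§1  (L1-KP) `bound118_linear_of_KP`: (2.38)_ℓ + Geometry + `SpRestr` + `Repr213` + `(1 − 10δ)ℓ = 1` + κ-largeness
    `κ + 2κ₀ + 2 ≤ (1 − 8δ)ℓκ` + KP smallness `C₃ε₁e^{5κ+1}K₀νc₁ ≤ 1` + `e·ν·c₁·K₀² ≤ A₂` ⟹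
    `Bound118 S.Dk1 S.sp2 S.Ek1 (remActivity c) c.κ` (= `RemainderChain.bound118_linear_of_bound241With` ∘
    `B13Resummation.cammarotaStepWith_of_KP_R22gen`; R23 NOT used); `h118_linear_of_KP` = the same through the (4.4) seam.
§2  THE PRINTED O(1) OF (2.41), EXPLICIT: `A2geom G := e·ν·c₁·K₀²` (`A2geom_nonneg`, `hA₂_of_A2geom_le`); on the torus
    carrier it is the SAME number for every torus size N (`A2geom_tgeometry`), for d = 4 `e·9·64·K₀(64,8)²`
    (`A2geom_tgeometry_four`) — k-free, volume-free, history-free, ε₁-free, L-free.  The KP smallness is ε₁ times an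
    ε₁-free rate (`kpRate`, `kpSmall_iff`: ONE MORE upper bound on ε₁ after L, κ — the printed TYPE «ε₁ sufficiently
    small», p. 21); the κ-largeness under `(1 − 10δ)ℓ = 1` is the explicit LOWER bound `10(κ₀ + 1) ≤ (ℓ − 1)κ`
    (`large_iff_of_R22gen`; printed ℓ = ½L: `20(κ₀ + 1) ≤ (L − 2)κ`, `large_iff_of_R22`) — the printed TYPE «κ sufficiently
    large»; on the d = 4 torus the three numeric conditions are N-free (`kpConds_tgeometry_four`).  Joint satisfiability of
    the ε₁-restrictions of the R10 road at fixed L ≥ 2 INCLUDING the co-lead's strictness for (2.46)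
    (`Beta.ConstRemainderConsumers`: `r < b`): `exists_eps1_lt_and_le` — `∃ ε₁ > 0, ε₁·K < b·log L ∧ ε₁·R ≤ 1`.
§3  THE LEAF LIST AT LEMMA-3 GRADE: `PolLeavesKP` = per torus index n a `B13.StepData`, its polymer `Geometry`, `SpRestr`,
    `Repr213`, (2.38)_ℓ, the three numeric conditions, the [I] (4.4) embedding seam (`emb`, `hemb`, `hcomp`), and the
    [I] §§4–5 leaves of `RemainderChain.PolLeaves` VERBATIM (analyticity on the α₂-ball, `hrepr`, (4.35), (4.37)/(0.26),
    cube and tree sums, (5.1)); `PolLeavesKP.toPolLeaves` (the `h118` leaf now DERIVED, §1); `ChainKP` / `ChainKP.toChain`;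
    `ChainKP.abs_beta1_le : RemainderConst S γ (ε₁·K_rem)` — the k-UNIFORM constant-form remainder bound with the SAME
    `K_rem = remCoeff` as `RemainderChain.Chain.abs_beta1_le`, its [II]-side input now (2.38) instead of (2.41).
§4  The RULING (R10) END consumers BY NAME: `betaPartialSumsLowerH_of_telescope_chainKP`,
    `endpointExistence_of_telescope_chainKP` (`Beta.DriftRemainder` §4 ∘ `toChain`; `ε₁·K_rem ≤ b·log L`).
CONSTANTS' k-DEPENDENCE (the row's deliverable, cell record `BETA/REMAINDER-BETA.md` v1.8 §2): in `ChainKP` ONE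
`c : B13.Consts` (L, M, q, κ, κ₁, δ, δ₀, E₀, ε₁, C₁, C₂, α's, γ₂, γ, the O(1)'s A₁, A₂), ONE ℓ and ONE (α₂, B₃, c₁, K₀, K₁)
serve EVERY scale k, EVERY history in `]0,γ]^{k+1}` and EVERY torus index n; with `G n := tgeometry 4 (N n)` the three
numeric conditions are the N-free numbers of `kpConds_tgeometry_four`.  That the printed objects satisfy the leaves with
such constants is what print asserts display by display (REMAINDER-BETA §2 table) and is NOT proved here.

WHAT IS NOT HERE.  Lemma 3 itself (pp. 12–20; GAPS G-B13-07…10), (2.13)/(I.1.7) for Bałaban's E^{(k+1)} (`Repr213` is a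
binder), the p. 15 restriction property (`SpRestr`, binder), the [I] leaves (G-B12s-15 (a)–(g), G-adv2-2), the dictionary
clause `beta1_eq` ((1.20)/(1.22) applied to the (2.13)-half), the one-loop side (AF-0)/(M2⁺) — the sub-cell's wall —
and `BetaPertH`.  References (CONTEXT ONLY): [I] T. Bałaban, CMP 109 (1987) 249–301; [II] T. Bałaban, CMP 116 (1988)
1–22; R. Kotecký, D. Preiss, CMP 103 (1986) 491–498; [B16] T. Bałaban, CMP 122 (1989) 355–392, p. 355.
-/

namespace Literature.MathematicalPhysics.QuantumFieldTheory.Balaban1983to89.Beta.RemainderChainKP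

open Literature.MathematicalPhysics.QuantumFieldTheory.Balaban1983to89
open FlowStep DagBinding FlowStepRuns
open Literature.MathematicalPhysics.QuantumFieldTheory.Balaban1983to89.B13Resummation
  (Geometry SpRestr Repr213 cammarotaStepWith_of_KP_R22gen)
open Literature.MathematicalPhysics.QuantumFieldTheory.Balaban1983to89.Beta.RemainderChain
open Literature.MathematicalPhysics.QuantumFieldTheory.Balaban1983to89.Beta.DriftRemainder
  (betaPartialSumsLowerH_of_telescope_chain endpointExistence_of_telescope_chain)
open Literature.MathematicalPhysics.QuantumFieldTheory.Balaban1983to89.TreeLengthTorusGeometry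
  (tgeometry tgeometry_consts tgeometry_consts_four)
open Metric Filter Topology

noncomputable section

/-! ## 1. (L1-KP): Lemma 3's (2.38) + polymer geometry + (2.13) ⟹ the (I.1.18)-shape bound with LINEAR activity -/

/-- **(L1-KP), kernel-checked.**  For step data `S` with constants `c`, a transfer factor ℓ with `(1 − 10δ)ℓ = 1`
(p. 21 *"At first we assume that (1 − 10δ)½L = 1"*), the polymer geometry `G` of 𝐃_{k+1}, the restriction property of
the spaces (p. 15) and the representation (2.13): Lemma 3's bound (2.38)_ℓ on the activities, *"κ sufficiently large"*
:= `κ + 2κ₀ + 2 ≤ (1 − 8δ)ℓκ`, *"ε₁ sufficiently small"* := `C₃ε₁e^{5κ+1}K₀νc₁ ≤ 1` and the printed O(1) `≥ e·ν·c₁·K₀²`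
give the (I.1.18)-shape bound on the (2.13)-terms with activity `A_rem = O(1)C₃ε₁` and rate κ:
`|E^{(k+1)}(X)| ≤ O(1)C₃ε₁ e^{−κ d_{k+1}(X)}` on `𝐔ᶜ_{k+1}(X, α₀, α₁)`.  The second "last assumption" `O(1)C₃ε₁ ≤ ½E₀`
(R23) is NOT used: the activity stays LINEAR in ε₁.  `RemainderChain.bound118_linear_of_bound241With` ∘
`B13Resummation.cammarotaStepWith_of_KP_R22gen` (engine: Kotecký–Preiss, tree-proved).
[cite: Balaban1988RG2Cluster, (2.38) p.20 and (2.41) p.21] -/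
theorem bound118_linear_of_KP (S : B13.StepData) (c : B13.Consts) (ℓ : ℝ) {Cube : Type} [DecidableEq Cube]
    (G : Geometry S.Dk1 Cube) (hsp : SpRestr S G) (hrep : Repr213 S G) (h238 : B13.Bound238With S c ℓ)
    (h22 : c.R22gen ℓ) (hA : 0 ≤ c.C3act * c.ε₁) (hκ : 0 ≤ c.κ)
    (hlarge : c.κ + 2 * G.κ₀ + 2 ≤ (1 - 8 * c.δ) * ℓ * c.κ)
    (hsmall : c.C3act * c.ε₁ * Real.exp (5 * c.κ + 1) * G.K₀ * G.ν * G.c₁ ≤ 1)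
    (hA₂ : Real.exp 1 * G.ν * G.c₁ * G.K₀ ^ 2 ≤ c.A₂) :
    B13.Bound118 S.Dk1 S.sp2 S.Ek1 (remActivity c) c.κ :=
  bound118_linear_of_bound241With S c
    (cammarotaStepWith_of_KP_R22gen S c G hsp hrep h22 hA hκ hlarge hsmall hA₂ h238) h22

/-- (L1-KP) through the seam of [I] (4.4) p. 281 (`RemainderChain.h118_of_bound118`): if `emb X` maps the radius-α₂
ball of the external-field space into `𝐔ᶜ_{k+1}(X, α₀, α₁)` and `EX X = E^{(k+1)}(X) ∘ emb X`, the hypotheses of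
`bound118_linear_of_KP` give the `h118` leaf of `RemainderChain.PolLeaves` on the ball with activity `A_rem` and rate κ.
[cite: Balaban1987RG1, (4.4) p.281; Balaban1988RG2Cluster, (2.38) p.20] -/
theorem h118_linear_of_KP (S : B13.StepData) (c : B13.Consts) (ℓ : ℝ) {Cube : Type} [DecidableEq Cube]
    (G : Geometry S.Dk1 Cube) (hsp : SpRestr S G) (hrep : Repr213 S G) (h238 : B13.Bound238With S c ℓ)
    (h22 : c.R22gen ℓ) (hA : 0 ≤ c.C3act * c.ε₁) (hκ : 0 ≤ c.κ)
    (hlarge : c.κ + 2 * G.κ₀ + 2 ≤ (1 - 8 * c.δ) * ℓ * c.κ)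
    (hsmall : c.C3act * c.ε₁ * Real.exp (5 * c.κ + 1) * G.K₀ * G.ν * G.c₁ ≤ 1)
    (hA₂ : Real.exp 1 * G.ν * G.c₁ * G.K₀ ^ 2 ≤ c.A₂) {W : Type*} [NormedAddCommGroup W]
    (emb : S.Dk1.Dom → W → S.Φ) (EX : S.Dk1.Dom → W → ℂ) {α₂ : ℝ}
    (hemb : ∀ X, ∀ v ∈ ball (0 : W) α₂, emb X v ∈ S.sp2 X) (hcomp : ∀ X v, EX X v = S.Ek1 X (emb X v)) :
    ∀ X, ∀ v ∈ ball (0 : W) α₂, ‖EX X v‖ ≤ remActivity c * Real.exp (-c.κ * S.Dk1.dj X) :=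
  h118_of_bound118 S.sp2 S.Ek1 emb EX hemb hcomp
    (bound118_linear_of_KP S c ℓ G hsp hrep h238 h22 hA hκ hlarge hsmall hA₂)

/-! ## 2. The printed O(1) of (2.41) EXPLICIT; the two "sufficiently" as explicit restrictions of printed type -/

/-- THE PRINTED O(1) OF (2.41), made explicit by the Kotecký–Preiss route (`B13Resummation.norm_locE_le_of_small`):
`O(1) := e · ν · c₁ · K₀²` — ν = the reach multiplicity of the incompatibility (2.11), c₁ = the additive volume
constant, K₀ = the constant of (1.26) at scale k + 1; a function of the polymer geometry of the unit cubes ONLY.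
[cite: Balaban1988RG2Cluster, (2.41) p.21] -/
def A2geom {D : LocDomainSys} {Cube : Type} [DecidableEq Cube] (G : Geometry D Cube) : ℝ :=
  Real.exp 1 * G.ν * G.c₁ * G.K₀ ^ 2

/-- `O(1) = e·ν·c₁·K₀² ≥ 0`. [folklore] -/
theorem A2geom_nonneg {D : LocDomainSys} {Cube : Type} [DecidableEq Cube] (G : Geometry D Cube) : 0 ≤ A2geom G := by
  unfold A2geom
  have := G.ν_nonneg; have := G.c₁_nonneg
  positivity

/-- Choosing the (2.41)-constant `A₂ ≥ e·ν·c₁·K₀²` discharges the hypothesis `hA₂` of §1. [folklore] -/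
theorem hA₂_of_A2geom_le {D : LocDomainSys} {Cube : Type} [DecidableEq Cube] (G : Geometry D Cube) {A₂ : ℝ}
    (h : A2geom G ≤ A₂) : Real.exp 1 * G.ν * G.c₁ * G.K₀ ^ 2 ≤ A₂ := h

/-- On the periodic carrier of the papers (the torus of N^d unit cubes, `TreeLengthTorusGeometry.tgeometry`) the
(2.41)-constant is `e·(2d+1)·(4·2^d)·K₀(4·2^d, 2d)²` — the SAME number for every torus size N: volume-free, hence
k-free along the sequence of lattices. [cite: Balaban1988RG2Cluster, (2.41) p.21] -/
theorem A2geom_tgeometry (d N : ℕ) [NeZero N] : A2geom (tgeometry d N) =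
    Real.exp 1 * (2 * (d : ℝ) + 1) * (4 * 2 ^ d) * B12TreeDecay.K₀ (4 * 2 ^ d) (2 * d) ^ 2 := by
  obtain ⟨hν, -, hK, hc⟩ := tgeometry_consts d N
  rw [A2geom, hν, hK, hc]

/-- d = 4: the (2.41)-constant on the torus is `e · 9 · 64 · K₀(64, 8)²` for every N. [cite: Balaban1988RG2Cluster, (2.41) p.21] -/
theorem A2geom_tgeometry_four (N : ℕ) [NeZero N] :
    A2geom (tgeometry 4 N) = Real.exp 1 * 9 * 64 * B12TreeDecay.K₀ 64 8 ^ 2 := by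
  rw [A2geom_tgeometry]
  have h9 : 2 * ((4 : ℕ) : ℝ) + 1 = 9 := by norm_num
  have h64 : (4 : ℝ) * 2 ^ 4 = 64 := by norm_num
  have hK : B12TreeDecay.K₀ (4 * 2 ^ 4) (2 * 4) = B12TreeDecay.K₀ 64 8 := by norm_num
  rw [hK, h9, h64]

/-- The ε₁-FREE rate of the Kotecký–Preiss smallness: `R_KP := C₃ · e^{5κ+1} · K₀ · ν · c₁` (C₃ = `C3act` carries no ε₁,
p. 20). [cite: Balaban1988RG2Cluster, p.20 (definition of C₃) and (2.39) p.21] -/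
def kpRate (c : B13.Consts) {D : LocDomainSys} {Cube : Type} [DecidableEq Cube] (G : Geometry D Cube) : ℝ :=
  c.C3act * Real.exp (5 * c.κ + 1) * G.K₀ * G.ν * G.c₁

/-- *"ε₁ sufficiently small"* (p. 21) in the Kotecký–Preiss form is ONE MORE UPPER BOUND ON ε₁ given the preceding
constants: `C₃ε₁e^{5κ+1}K₀νc₁ ≤ 1 ↔ ε₁ · R_KP ≤ 1` — the printed TYPE of restriction (the cell's wording, not a
quotation). [cite: Balaban1988RG2Cluster, p.21 (after (2.39))] -/
theorem kpSmall_iff (c : B13.Consts) {D : LocDomainSys} {Cube : Type} [DecidableEq Cube] (G : Geometry D Cube) :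
    c.C3act * c.ε₁ * Real.exp (5 * c.κ + 1) * G.K₀ * G.ν * G.c₁ ≤ 1 ↔ c.ε₁ * kpRate c G ≤ 1 := by
  unfold kpRate
  constructor <;> intro h <;> nlinarith [h]

/-- On the torus the rate is N-free: `R_KP = C₃ e^{5κ+1} K₀(4·2^d, 2d) (2d+1) 4·2^d`. [folklore] -/
theorem kpRate_tgeometry (c : B13.Consts) (d N : ℕ) [NeZero N] : kpRate c (tgeometry d N) =
    c.C3act * Real.exp (5 * c.κ + 1) * B12TreeDecay.K₀ (4 * 2 ^ d) (2 * d) * (2 * (d : ℝ) + 1) * (4 * 2 ^ d) := by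
  obtain ⟨hν, -, hK, hc⟩ := tgeometry_consts d N
  rw [kpRate, hν, hK, hc]

/-- *"κ sufficiently large"* (p. 21) in the Kotecký–Preiss form, under the closing condition `(1 − 10δ)ℓ = 1`, is the
explicit LOWER bound `10(κ₀ + 1) ≤ (ℓ − 1)κ` on κ given ℓ and the (1.26)-rate κ₀ (since then `(1 − 8δ)ℓκ = κ + 2δℓκ` and
`10δℓ = ℓ − 1`). [cite: Balaban1988RG2Cluster, p.21 (after (2.39))] -/
theorem large_iff_of_R22gen (c : B13.Consts) {ℓ : ℝ} (h22 : c.R22gen ℓ) (κ₀ : ℝ) :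
    c.κ + 2 * κ₀ + 2 ≤ (1 - 8 * c.δ) * ℓ * c.κ ↔ 10 * (κ₀ + 1) ≤ (ℓ - 1) * c.κ := by
  have h : (1 - 10 * c.δ) * ℓ = 1 := h22
  have e : (1 - 8 * c.δ) * ℓ * c.κ = c.κ + (ℓ - 1) * c.κ / 5 := by
    have hδ : c.δ * ℓ = (ℓ - 1) / 10 := by linarith
    have : (1 - 8 * c.δ) * ℓ = ℓ - 8 * (c.δ * ℓ) := by ring
    rw [this, hδ]; ring
  rw [e]
  constructor <;> intro hh <;> linarith

/-- The printed transfer factor ℓ = ½L (`B13.Consts.R22`): *"κ sufficiently large"* reads `20(κ₀ + 1) ≤ (L − 2)κ`.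
[cite: Balaban1988RG2Cluster, p.21 (after (2.39))] -/
theorem large_iff_of_R22 (c : B13.Consts) (h22 : c.R22) (κ₀ : ℝ) :
    c.κ + 2 * κ₀ + 2 ≤ (1 - 8 * c.δ) * ((c.L : ℝ) / 2) * c.κ ↔ 20 * (κ₀ + 1) ≤ ((c.L : ℝ) - 2) * c.κ := by
  rw [large_iff_of_R22gen c ((B13.Consts.R22gen_half_iff c).mpr h22) κ₀]
  constructor <;> intro hh <;> linarith

/-- d = 4 ON THE TORUS: the three numeric conditions of §1 for `G := tgeometry 4 N` follow from THREE N-FREE NUMERIC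
CONDITIONS on (κ, δ, ℓ, C₃ε₁, A₂) — κ₀ = 64 log 162, ν = 9, c₁ = 64, K₀ = K₀(64, 8)
(`TreeLengthTorusGeometry.tgeometry_consts_four`): the (I1) link's restrictions are k-free and volume-free.
[cite: Balaban1988RG2Cluster, p.21 (after (2.39))] -/
theorem kpConds_tgeometry_four (c : B13.Consts) {ℓ : ℝ}
    (hlarge : c.κ + 2 * (64 * Real.log 162) + 2 ≤ (1 - 8 * c.δ) * ℓ * c.κ)
    (hsmall : c.C3act * c.ε₁ * Real.exp (5 * c.κ + 1) * B12TreeDecay.K₀ 64 8 * 9 * 64 ≤ 1)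
    (hA₂ : Real.exp 1 * 9 * 64 * B12TreeDecay.K₀ 64 8 ^ 2 ≤ c.A₂) (N : ℕ) [NeZero N] :
    (c.κ + 2 * (tgeometry 4 N).κ₀ + 2 ≤ (1 - 8 * c.δ) * ℓ * c.κ) ∧
      (c.C3act * c.ε₁ * Real.exp (5 * c.κ + 1) * (tgeometry 4 N).K₀ * (tgeometry 4 N).ν *
          (tgeometry 4 N).c₁ ≤ 1) ∧
      (Real.exp 1 * (tgeometry 4 N).ν * (tgeometry 4 N).c₁ * (tgeometry 4 N).K₀ ^ 2 ≤ c.A₂) := by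
  obtain ⟨hν, hκ₀, hc⟩ := tgeometry_consts_four N
  obtain ⟨-, -, hK, -⟩ := tgeometry_consts 4 N
  have hK' : B12TreeDecay.K₀ (4 * 2 ^ 4) (2 * 4) = B12TreeDecay.K₀ 64 8 := by norm_num
  rw [hK'] at hK
  refine ⟨?_, ?_, ?_⟩
  · rw [hκ₀]; exact hlarge
  · rw [hK, hν, hc]; exact hsmall
  · rw [hK, hν, hc]; exact hA₂

/-- JOINT SATISFIABILITY of the ε₁-restrictions of the RULING (R10) road at FIXED `L ≥ 2` (every one an upper bound on
ε₁ AFTER L, κ, …; the printed order, [I] Thm 3 p. 264: γ after ε₁): for `b > 0` (= `stepBal N L / log L`-type slope),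
any remainder coefficient `K` (= `K_rem(L)`) and any rate `R ≥ 0` (= `R_KP`, or `2·O(1)C₃/E₀` for R23) there is
`ε₁ > 0` with `ε₁·K < b·log L` STRICTLY — the strictness the [III]-side consumer of (2.46) needs
(`Beta.ConstRemainderConsumers`, co-lead strat-b14: `r < b`) — and `ε₁·R ≤ 1`. [folklore] -/
theorem exists_eps1_lt_and_le (b K R : ℝ) (hb : 0 < b) (hR : 0 ≤ R) {L : ℕ} (hL : 2 ≤ L) :
    ∃ ε₁ : ℝ, 0 < ε₁ ∧ ε₁ * K < b * Real.log L ∧ ε₁ * R ≤ 1 := by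
  have hlog : 0 < Real.log L := Real.log_pos (by exact_mod_cast hL)
  have hbl : 0 < b * Real.log L := mul_pos hb hlog
  obtain ⟨ε, hε, hεK⟩ := RemainderChain.exists_eps1_le (b * Real.log L / 2) K (by linarith)
  refine ⟨min ε (1 / (R + 1)), lt_min hε (by positivity), ?_, ?_⟩
  · rcases le_or_gt K 0 with hK | hK
    · have : min ε (1 / (R + 1)) * K ≤ 0 :=
        mul_nonpos_of_nonneg_of_nonpos (le_min hε.le (by positivity)) hK
      linarith
    · calc min ε (1 / (R + 1)) * K ≤ ε * K := by gcongr; exact min_le_left _ _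
        _ < b * Real.log L := by linarith
  · calc min ε (1 / (R + 1)) * R ≤ 1 / (R + 1) * R := by gcongr; exact min_le_right _ _
      _ ≤ 1 := by rw [div_mul_eq_mul_div, one_mul, div_le_one (by linarith)]; linarith

/-! ## 3. The leaf list and the chain AT LEMMA-3 GRADE -/

/-- **THE LEAVES OF THE REMAINDER POLARIZATION AT LEMMA-3 GRADE** (cf. `RemainderChain.PolLeaves`, whose (I.1.18)-leaf
`h118` is here DERIVED): for each torus index n (the `T ↗ ℤ^d` limit (5.1) of [I] p. 264) — the [II]-side data: step data
`St n` with its (k+1)-system 𝐃_{k+1}, the polymer geometry `G n` of 𝐃_{k+1} ((2.11) p. 14; on the periodic carrier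
`TreeLengthTorusGeometry.TorusStep.geom`, constructed), the restriction property of the spaces (p. 15), the representation
(2.13), Lemma 3's bound (2.38)_ℓ, and the three numeric conditions (κ-largeness, KP ε₁-smallness, `O(1) ≥ e·ν·c₁·K₀²`);
the [I]-side seam (4.4) p. 281 (`emb`, `hemb`, `hcomp`: the radius-α₂ external-field ball maps into 𝐔ᶜ_{k+1}(X, α₀, α₁));
and the [I] §§4–5 leaves VERBATIM as in `RemainderChain.PolLeaves` (analyticity on the ball, the polarization terms as
second derivatives `hrepr`, (4.35) `hh`, (4.37)/(0.26) `hgeo`, cube sum `hcube`, tree sum `htree`, the ℓ¹-metric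
eventually `hρ`, the limit (5.1) `hlim`).  ONE `c`, ONE ℓ, ONE (α₂, B₃, c₁, K₀, K₁) for all n.  A HYPOTHESIS structure:
nothing of it is discharged here.  Carrier types in `Type`; the decidable equality of the cube types and the normed-space structures
of the external-field spaces are FIELDS (no global instance is registered, as in `RemainderChain.PolLeaves`). [cite: Balaban1988RG2Cluster, (2.38) p.20 and (2.13) p.14; Balaban1987RG1, (4.37) p.291 and (5.10) p.293] -/
structure PolLeavesKP (d : ℕ) (P : (Fin d → ℤ) → ℝ) (c : B13.Consts) (ℓ α₂ B₃ c₁ K₀ K₁ : ℝ) where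
  St : ℕ → B13.StepData
  Cube : ℕ → Type
  [decCube : ∀ n, DecidableEq (Cube n)]
  G : (n : ℕ) → Geometry (St n).Dk1 (Cube n)
  hsp : ∀ n, SpRestr (St n) (G n)
  hrep : ∀ n, Repr213 (St n) (G n)
  h238 : ∀ n, B13.Bound238With (St n) c ℓ
  hlarge : ∀ n, c.κ + 2 * (G n).κ₀ + 2 ≤ (1 - 8 * c.δ) * ℓ * c.κ
  hsmall : ∀ n, c.C3act * c.ε₁ * Real.exp (5 * c.κ + 1) * (G n).K₀ * (G n).ν * (G n).c₁ ≤ 1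
  hA₂ : ∀ n, Real.exp 1 * (G n).ν * (G n).c₁ * (G n).K₀ ^ 2 ≤ c.A₂
  Cn : (n : ℕ) → B12.CubeCover (St n).Dk1
  Λn : ℕ → Type
  Gn : (n : ℕ) → B12Decay510.SiteGeometry (Cn n) (Λn n)
  ρn : (n : ℕ) → Λn n → Λn n → ℝ
  Wn : ℕ → Type
  [instW : ∀ n, NormedAddCommGroup (Wn n)]
  [instWs : ∀ n, NormedSpace ℂ (Wn n)]
  EXn : (n : ℕ) → (St n).Dk1.Dom → Wn n → ℂ
  emb : (n : ℕ) → (St n).Dk1.Dom → Wn n → (St n).Φ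
  hemb : ∀ n X, ∀ v ∈ ball (0 : Wn n) α₂, emb n X v ∈ (St n).sp2 X
  hcomp : ∀ n X v, EXn n X v = (St n).Ek1 X (emb n X v)
  hn : (n : ℕ) → (St n).Dk1.Dom → Λn n → Wn n
  E2n : (n : ℕ) → (St n).Dk1.Dom → Λn n → Λn n → ℝ
  e : (n : ℕ) → (Fin d → ℤ) → Λn n
  han : ∀ n X, AnalyticOnNhd ℂ (EXn n X) (ball 0 α₂)
  hrepr : ∀ n X x y, E2n n X x y = (B12Decay510.mixedDeriv (EXn n X) (hn n X x) (hn n X y)).re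
  hh : ∀ n X x, ‖hn n X x‖ ≤ B₃ * Real.exp (-c.δ₀ * (Gn n).distD x X)
  hgeo : ∀ n, B12Decay510.GeomLeaf (Gn n) (ρn n) c.M c₁
  hcube : ∀ n, B12Decay510.CubeSumLeaf (Gn n) (c.δ₀ / 2) K₁
  htree : ∀ n, B12Decay510.TreeLeaf (Cn n) (c.κ / 2) K₀
  hρ : ∀ z, ∀ᶠ n in atTop, ρn n (e n 0) (e n z) = B12Sec2to5.l1 z
  hlim : ∀ z, Tendsto (fun n => ∑ X, E2n n X (e n 0) (e n z)) atTop (𝓝 (P z))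


/-- **The Lemma-3-grade leaves give the (2.41)-grade leaves of `RemainderChain.PolLeaves`** with activity
`A_rem = O(1)C₃ε₁` and rate κ — the (I.1.18)-leaf `h118` DERIVED by §1 (Kotecký–Preiss + `(1 − 10δ)ℓ = 1`), every other
leaf carried over verbatim. [cite: Balaban1988RG2Cluster, (2.38) p.20 and (2.41) p.21; Balaban1987RG1, (4.4) p.281] -/
def PolLeavesKP.toPolLeaves {d : ℕ} {P : (Fin d → ℤ) → ℝ} {c : B13.Consts} {ℓ α₂ B₃ c₁ K₀ K₁ : ℝ}
    (Lv : PolLeavesKP d P c ℓ α₂ B₃ c₁ K₀ K₁) (h22 : c.R22gen ℓ) (hA : 0 ≤ c.C3act * c.ε₁) (hκ : 0 ≤ c.κ) :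
    PolLeaves d P (remActivity c) α₂ B₃ c.κ c.δ₀ c.M c₁ K₀ K₁ where
  Sn := fun n => (Lv.St n).Dk1
  Cn := Lv.Cn
  Λn := Lv.Λn
  Gn := Lv.Gn
  ρn := Lv.ρn
  Wn := Lv.Wn
  instW := Lv.instW
  instWs := Lv.instWs
  EXn := Lv.EXn
  hn := Lv.hn
  E2n := Lv.E2n
  e := Lv.e
  han := Lv.han
  h118 := fun n => by
    letI := Lv.decCube n
    letI := Lv.instW n
    exact h118_linear_of_KP (Lv.St n) c ℓ (Lv.G n) (Lv.hsp n) (Lv.hrep n) (Lv.h238 n) h22 hA hκ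
      (Lv.hlarge n) (Lv.hsmall n) (Lv.hA₂ n) (Lv.emb n) (Lv.EXn n) (Lv.hemb n) (Lv.hcomp n)
  hrepr := Lv.hrepr
  hh := Lv.hh
  hgeo := Lv.hgeo
  hcube := Lv.hcube
  htree := Lv.htree
  hρ := Lv.hρ
  hlim := Lv.hlim

/-- Hence (L2)–(L3) at Lemma-3 grade: the leaves give the (5.10)-decay `|P(x)| ≤ A_rem·K_Π·e^{−δ₁|x|₁}` with the SAME
`K_Π = polConst` as `RemainderChain.PolLeaves.decay510`. [cite: Balaban1987RG1, (5.10) p.293] -/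
theorem PolLeavesKP.decay510 {d : ℕ} {P : (Fin d → ℤ) → ℝ} {c : B13.Consts} {ℓ α₂ B₃ c₁ K₀ K₁ : ℝ}
    (Lv : PolLeavesKP d P c ℓ α₂ B₃ c₁ K₀ K₁) (h22 : c.R22gen ℓ) (hA : 0 ≤ c.C3act * c.ε₁) (hs : ChainSigns c α₂ B₃ K₀) :
    B12Sec2to5.Decay510 P (remActivity c * polConst α₂ B₃ c.κ c.δ₀ c.M c₁ K₀ K₁)
      (B12Decay510.delta1 c.δ₀ c.κ c.M) :=
  (Lv.toPolLeaves h22 hA hs.κ_pos.le).decay510 hs.α₂_pos hs.act hs.B₃_nonneg hs.K₀_nonneg hs.δ₀_pos.le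
    hs.κ_pos.le hs.M_pos

/-- **THE REMAINDER CHAIN AT LEMMA-3 GRADE** for the β-family `β` with one-loop split `S` on the boxes `]0,γ]^{k+1}`
(cf. `RemainderChain.Chain`): `P1 k p` = the `T ↗ ℤ^d` limit polarization kernel of the (2.13)-half at scale k + 1 and
history p; `beta1_eq` = the dictionary clause ((1.20)/(1.22) applied to that half); `leaves k p hp` = the Lemma-3-grade
leaf list with THE SAME constants `c, ℓ, α₂, B₃, c₁, K₀, K₁` for every k and every history.  A HYPOTHESIS structure.
[cite: Balaban1987RG1, (1.20)-(1.22) p.264; Balaban1988RG2Cluster, (2.38) p.20] -/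
structure ChainKP (d : ℕ) (μ ν : Fin d) {β : HBeta} (S : B12Beta.OneLoopSplit β) (γ : ℝ) (c : B13.Consts)
    (ℓ α₂ B₃ c₁ K₀ K₁ : ℝ) where
  P1 : (k : ℕ) → (Fin (k + 1) → ℝ) → B12Beta.Kernel d
  beta1_eq : ∀ k p, p ∈ B12Beta.HistBox γ k → S.β1 k p = B12Beta.secondMoment (P1 k p) μ ν
  leaves : ∀ k p, p ∈ B12Beta.HistBox γ k → PolLeavesKP d (P1 k p μ ν) c ℓ α₂ B₃ c₁ K₀ K₁

/-- The Lemma-3-grade chain gives the (2.41)-grade chain `RemainderChain.Chain` (same `P1`, same dictionary clause,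
leaves through `PolLeavesKP.toPolLeaves`). [cite: Balaban1988RG2Cluster, (2.38) p.20 and (2.41) p.21] -/
def ChainKP.toChain {d : ℕ} {μ ν : Fin d} {β : HBeta} {S : B12Beta.OneLoopSplit β} {γ : ℝ} {c : B13.Consts}
    {ℓ α₂ B₃ c₁ K₀ K₁ : ℝ} (R : ChainKP d μ ν S γ c ℓ α₂ B₃ c₁ K₀ K₁) (h22 : c.R22gen ℓ)
    (hA : 0 ≤ c.C3act * c.ε₁) (hκ : 0 ≤ c.κ) : Chain d μ ν S γ c α₂ B₃ c₁ K₀ K₁ where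
  P1 := R.P1
  beta1_eq := R.beta1_eq
  leaves := fun k p hp => (R.leaves k p hp).toPolLeaves h22 hA hκ

/-- **THE k-UNIFORM REMAINDER BOUND FROM LEMMA 3's (2.38), kernel-checked modulo the named leaves**: a Lemma-3-grade
chain with the printed signs gives `|β¹_{k+1}(g_0,…,g_k)| ≤ ε₁ · K_rem` for EVERY scale k and EVERY history in
`]0,γ]^{k+1}` — the SAME ε₁-free coefficient `K_rem = remCoeff d c α₂ B₃ c₁ K₀ K₁ = O(1)·C₃·β′_d(K_Π, δ₁)` as
`RemainderChain.Chain.abs_beta1_le`, with `O(1) = A₂ ≥ e·ν·c₁·K₀²` now explicit and the [II]-side input (2.38) in place of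
(2.41).  O(ε₁), not O(g_k), not O(γ²). [cite: Balaban1988RG2Cluster, (2.38) p.20; Balaban1987RG1, (5.10) p.293 and (1.22) p.264] -/
theorem ChainKP.abs_beta1_le {d : ℕ} {μ ν : Fin d} {β : HBeta} {S : B12Beta.OneLoopSplit β} {γ : ℝ}
    {c : B13.Consts} {ℓ α₂ B₃ c₁ K₀ K₁ : ℝ} (R : ChainKP d μ ν S γ c ℓ α₂ B₃ c₁ K₀ K₁) (h22 : c.R22gen ℓ)
    (hA : 0 ≤ c.C3act * c.ε₁) (hs : ChainSigns c α₂ B₃ K₀) :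
    RemainderConst S γ (c.ε₁ * remCoeff d c α₂ B₃ c₁ K₀ K₁) :=
  (R.toChain h22 hA hs.κ_pos.le).abs_beta1_le hs

/-- The one-sided form `−ε₁K_rem ≤ β¹_{k+1}` on the boxes — the binder shape of RULING (R10)'s remainder slot
(`Beta.DriftRemainder` §1, `Beta.ConstRemainderConsumers` §1 `hlow`). [folklore] -/
theorem ChainKP.neg_le_beta1 {d : ℕ} {μ ν : Fin d} {β : HBeta} {S : B12Beta.OneLoopSplit β} {γ : ℝ}
    {c : B13.Consts} {ℓ α₂ B₃ c₁ K₀ K₁ : ℝ} (R : ChainKP d μ ν S γ c ℓ α₂ B₃ c₁ K₀ K₁) (h22 : c.R22gen ℓ)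
    (hA : 0 ≤ c.C3act * c.ε₁) (hs : ChainSigns c α₂ B₃ K₀) :
    ∀ k (p : Fin (k + 1) → ℝ), p ∈ B12Beta.HistBox γ k → -(c.ε₁ * remCoeff d c α₂ B₃ c₁ K₀ K₁) ≤ S.β1 k p :=
  fun k p hp => (abs_le.mp (R.abs_beta1_le h22 hA hs k p hp)).1

/-! ## 4. The RULING (R10) END consumers, by name -/

/-- **`BetaPartialSumsLowerH` from telescoping + the Lemma-3-grade remainder chain** (the R10 primary road's END grade,
`Beta.DriftRemainder.betaPartialSumsLowerH_of_telescope_chain` ∘ `toChain`): (T1) `Σ_{j<k} β⁰_j = B(L^k)`, (T2)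
`|B(n) − b log n| ≤ A` (n ≥ 2), the chain with the printed signs, and the printed-type restriction `ε₁·K_rem ≤ b·log L`
give `BetaPartialSumsLowerH (2A) γ₀ β`. [cite: Balaban1987RG1, Thm 2 p.259 (first sentence); Balaban1988RG2Cluster, (2.38) p.20] -/
theorem betaPartialSumsLowerH_of_telescope_chainKP {d : ℕ} {μ ν : Fin d} {β : HBeta} {S : B12Beta.OneLoopSplit β}
    {γ₀ : ℝ} {c : B13.Consts} {ℓ α₂ B₃ c₁ K₀ K₁ b A : ℝ} {B : ℕ → ℝ} {L : ℕ}
    (R : ChainKP d μ ν S γ₀ c ℓ α₂ B₃ c₁ K₀ K₁) (h22 : c.R22gen ℓ) (hA₁ : 0 ≤ c.C3act * c.ε₁)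
    (hs : ChainSigns c α₂ B₃ K₀) (hL : 2 ≤ L) (hA : 0 ≤ A)
    (hTel : ∀ k : ℕ, ∑ j ∈ Finset.range k, S.β0 j = B (L ^ k))
    (hB : ∀ n : ℕ, 2 ≤ n → |B n - b * Real.log n| ≤ A)
    (hε₁ : c.ε₁ * remCoeff d c α₂ B₃ c₁ K₀ K₁ ≤ b * Real.log L) : BetaPartialSumsLowerH (2 * A) γ₀ β :=
  betaPartialSumsLowerH_of_telescope_chain (R.toChain h22 hA₁ hs.κ_pos.le) hs hL hA hTel hB hε₁

/-- **ENDPOINT EXISTENCE from telescoping + the Lemma-3-grade remainder chain** ([I] Thm 2 first sentence for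
forward-generated constructions; `Beta.DriftRemainder.endpointExistence_of_telescope_chain` ∘ `toChain`).
[cite: Balaban1987RG1, Thm 2 p.259 (first sentence); Balaban1988RG2Cluster, (2.38) p.20] -/
theorem endpointExistence_of_telescope_chainKP {C : B12.Construction} {β : HBeta} (hgen : ForwardGenerated C β)
    {S : B12Beta.OneLoopSplit β} {d : ℕ} {μ ν : Fin d} {c : B13.Consts} {ℓ α₂ B₃ c₁ K₀ K₁ γ₀ b A β' : ℝ}
    {B : ℕ → ℝ} {L : ℕ} (R : ChainKP d μ ν S γ₀ c ℓ α₂ B₃ c₁ K₀ K₁) (h22 : c.R22gen ℓ)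
    (hA₁ : 0 ≤ c.C3act * c.ε₁) (hs : ChainSigns c α₂ B₃ K₀) (hγ₀ : 0 < γ₀) (hL : 2 ≤ L) (hA : 0 ≤ A)
    (hTel : ∀ k : ℕ, ∑ j ∈ Finset.range k, S.β0 j = B (L ^ k))
    (hB : ∀ n : ℕ, 2 ≤ n → |B n - b * Real.log n| ≤ A)
    (hε₁ : c.ε₁ * remCoeff d c α₂ B₃ c₁ K₀ K₁ ≤ b * Real.log L) (hβ' : 0 ≤ β') (hcont : BetaContH γ₀ β)
    (hup : BetaUpperH β' γ₀ β) : EndpointExistence C :=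
  endpointExistence_of_telescope_chain hgen (R.toChain h22 hA₁ hs.κ_pos.le) hs hγ₀ hL hA hTel hB hε₁ hβ' hcont hup

end

end Literature.MathematicalPhysics.QuantumFieldTheory.Balaban1983to89.Beta.RemainderChainKP
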